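import Summits.QuantumFields.YangMills.Theorems.VirialFluxGapRingFrameBasis
import Summits.QuantumFields.YangMills.Theorems.VirialFluxGapFixFrame
import HarnessLib

/-!
# Route `VirialFluxGap` (YangMills): the STANDARD frame family of `X_fix` = fcl-p3's `stdFrame` restricted to the `X_fix` variables

Item (B) for the host `X_fix` (LEAD ruling 2026-08-30T23:30Z) of the ⟨stmt-QuantumFields-24141⟩ `PeriodicSoftness` team, aligned with the
master estimates ✓`FrameHessian.generic_drive_lower` ∕ ✓`generic_divergence_upper` of ✓`VirialFluxGapResolventFieldGeneric`, which ask a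
frame family with skew-Hermitian traceless slots of Frobenius norm `≤ 1`.  ✓`VirialFluxGapFixFrame` supplies the variables
(`FixVar L`, the injection `fixVar`, `exists_fixVar_or_tree`); ✓`VirialFluxGapRingFrameBasis` supplies fcl-p3's half-Pauli basis and the
standard family `stdFrame` of the ring space.  Here:

* ★ `fixFrameStd (v,a) := stdFrame (fixVar v, a)` — the half-Pauli direction `a` at the `X_fix` variable `v`; slots skew-Hermitian,
  traceless, Frobenius norm `≤ 1` (`fixFrameStd_conjTranspose` ∕ `_trace` ∕ `norm_fixFrameStd_le` — the hypotheses `hτ`, `hτ0`, `hτn` of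
  ✓`generic_divergence_upper` verbatim); `#ι = 3·#FixVar L`.
* `fixCoord Y (v,a) := stdCoord Y (fixVar v, a)` — the standard coordinates of an assignment read on the `X_fix` variables;
  ★★ `dirOf_fixFrameStd_fixCoord` — every skew-Hermitian traceless assignment VANISHING ON THE TREE LINKS OF SLICE `0` equals
  `dirOf fixFrameStd (fixCoord Y)` (the `X_fix` twin of ✓`dirOf_stdFrame_stdCoord`); `dirOf_fixFrameStd_tree` — conversely every
  `dirOf fixFrameStd u` vanishes there.
* ★ `fixCoord_dot_self_le` — `|fixCoord Y|² ≤ 12·Σ_w ‖Y w‖²` (from ✓`stdCoord_sq_le`; the `|u|²` of (G4) against chordal sizes).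

HONEST FRAMING: definitions and bookkeeping (two problem-side data definitions `fixFrameStd`, `fixCoord`; no `Prop`); ⟨24141⟩ and ⟨22884⟩ stay
OPEN; no stub ∕ crux ∕ rung ∕ summit is closed; the Yang–Mills mass gap is NOT proved; no summit is proved by a line.  0 `sorry`, standard axioms.
Width seat `ym-line-sfw-p2-w2` g51 (cell ym-idea-1, free hands), `--supports stmt-QuantumFields-24141`.  References: [folklore].
-/

set_option autoImplicit false

noncomputable section

open scoped Matrix BigOperators
open Matrix
open Literature.MathematicalPhysics.QuantumFieldTheory hiding SU2
open Literature.MathematicalPhysics.QuantumLattice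

namespace Summit.QuantumFields.YangMills.Theorems.VirialFluxGap.FixFrame

open Summit.QuantumFields.YangMills.Theorems.FemtoTransferGap
open Summit.QuantumFields.YangMills.Theorems.FemtoTransferGap.TT
open Summit.QuantumFields.YangMills.Theorems.VirialFluxGap.FrameDerivative
open Summit.QuantumFields.YangMills.Theorems.VirialFluxGap.FrameHessian

open scoped Matrix.Norms.Frobenius

variable {L : ℕ} [NeZero L]

/-! ## §1 The standard frame family of `X_fix` -/

/-- ★ The STANDARD FRAME FAMILY of `X_fix`: fcl-p3's `stdFrame` at the ring variable `fixVar v` — the half-Pauli direction `a` at the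
`X_fix` variable `v`, `0` at every other ring variable. [folklore] -/
def fixFrameStd (va : FixVar L × Fin 3) : ((Fin (2 * L - 1 + 1) × Edge 3 L) ⊕ Site 3 L) → Matrix (Fin 2) (Fin 2) ℂ :=
  stdFrame (fixVar va.1, va.2)

omit [NeZero L] in
/-- Slots of the standard `X_fix` frame. [folklore] -/
theorem fixFrameStd_apply (va : FixVar L × Fin 3) (w : (Fin (2 * L - 1 + 1) × Edge 3 L) ⊕ Site 3 L) :
    fixFrameStd va w = if w = fixVar va.1 then halfPauli va.2 else 0 := rfl

omit [NeZero L] in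
/-- The slots are skew-Hermitian (hypothesis `hτ` of ✓`generic_divergence_upper`). [folklore] -/
theorem fixFrameStd_conjTranspose (va : FixVar L × Fin 3) (w : (Fin (2 * L - 1 + 1) × Edge 3 L) ⊕ Site 3 L) :
    (fixFrameStd va w)ᴴ = -fixFrameStd va w :=
  stdFrame_conjTranspose _ _

omit [NeZero L] in
/-- The slots are traceless (hypothesis `hτ0`). [folklore] -/
theorem fixFrameStd_trace (va : FixVar L × Fin 3) (w : (Fin (2 * L - 1 + 1) × Edge 3 L) ⊕ Site 3 L) : (fixFrameStd va w).trace = 0 :=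
  stdFrame_trace _ _

omit [NeZero L] in
/-- The slots have Frobenius norm `≤ 1` (hypothesis `hτn`). [folklore] -/
theorem norm_fixFrameStd_le (va : FixVar L × Fin 3) (w : (Fin (2 * L - 1 + 1) × Edge 3 L) ⊕ Site 3 L) : ‖fixFrameStd va w‖ ≤ 1 :=
  norm_stdFrame_le _ _

/-- ★ The direction with coordinates `u` at an `X_fix` variable: `Y_u (fixVar v) = Σ_a u(v,a)·halfPauli a`. [folklore] -/
theorem dirOf_fixFrameStd_fixVar (u : FixVar L × Fin 3 → ℝ) (v : FixVar L) :
    dirOf (fixFrameStd (L := L)) u (fixVar v) = ∑ a, u (v, a) • halfPauli a := by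
  rw [dirOf, Finset.sum_apply, Fintype.sum_prod_type, Finset.sum_eq_single v]
  · refine Finset.sum_congr rfl fun a _ => ?_
    rw [Pi.smul_apply, fixFrameStd_apply, if_pos rfl]
  · intro v' _ hv'
    refine Finset.sum_eq_zero fun a _ => ?_
    rw [Pi.smul_apply, fixFrameStd_apply, if_neg (fun h => hv' (fixVar_injective h).symm), smul_zero]
  · intro h
    exact absurd (Finset.mem_univ v) h

/-- The direction with coordinates `u` vanishes off the image of `fixVar`. [folklore] -/
theorem dirOf_fixFrameStd_of_ne (u : FixVar L × Fin 3 → ℝ) {w : (Fin (2 * L - 1 + 1) × Edge 3 L) ⊕ Site 3 L} (hw : ∀ v, fixVar v ≠ w) :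
    dirOf (fixFrameStd (L := L)) u w = 0 := by
  rw [dirOf, Finset.sum_apply]
  refine Finset.sum_eq_zero fun va _ => ?_
  rw [Pi.smul_apply, fixFrameStd_apply, if_neg (fun h => hw va.1 h.symm), smul_zero]

/-- ★ Every `dirOf fixFrameStd u` vanishes on the tree links of slice `0`. [folklore] -/
theorem dirOf_fixFrameStd_tree (u : FixVar L × Fin 3 → ℝ) {e : Edge 3 L} (he : treeEdge e = true) :
    dirOf (fixFrameStd (L := L)) u (Sum.inl (0, e)) = 0 :=
  dirOf_fixFrameStd_of_ne u (fixVar_ne_tree he)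

/-! ## §2 Standard coordinates on `X_fix` -/

omit [NeZero L] in
/-- The standard coordinates of an assignment read on the `X_fix` variables: `fixCoord Y (v,a) = pauliCoord (Y (fixVar v)) a`. [folklore] -/
def fixCoord (Y : ((Fin (2 * L - 1 + 1) × Edge 3 L) ⊕ Site 3 L) → Matrix (Fin 2) (Fin 2) ℂ) (va : FixVar L × Fin 3) : ℝ :=
  stdCoord Y (fixVar va.1, va.2)

omit [NeZero L] in
/-- `fixCoord` entrywise. [folklore] -/
theorem fixCoord_apply (Y : ((Fin (2 * L - 1 + 1) × Edge 3 L) ⊕ Site 3 L) → Matrix (Fin 2) (Fin 2) ℂ) (va : FixVar L × Fin 3) :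
    fixCoord Y va = pauliCoord (Y (fixVar va.1)) va.2 := rfl

/-- The half-Pauli coordinates of `0` vanish. [folklore] -/
theorem pauliCoord_zero (a : Fin 3) : pauliCoord 0 a = 0 := by
  fin_cases a <;> simp [pauliCoord]

/-- ★★ **Coordinates on `X_fix`**: a skew-Hermitian traceless assignment vanishing on the tree links of slice `0` is the `fixFrameStd`-combination
of its `X_fix` coordinates. [folklore] -/
theorem dirOf_fixFrameStd_fixCoord {Y : ((Fin (2 * L - 1 + 1) × Edge 3 L) ⊕ Site 3 L) → Matrix (Fin 2) (Fin 2) ℂ}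
    (hY : ∀ w, (Y w)ᴴ = -Y w) (hY0 : ∀ w, (Y w).trace = 0) (htree : ∀ e : Edge 3 L, treeEdge e = true → Y (Sum.inl (0, e)) = 0) :
    dirOf (fixFrameStd (L := L)) (fixCoord Y) = Y := by
  funext w
  rcases exists_fixVar_or_tree w with ⟨v, rfl⟩ | ⟨e, he, rfl⟩
  · rw [dirOf_fixFrameStd_fixVar]
    exact (halfPauli_expand (hY _) (hY0 _)).symm
  · rw [dirOf_fixFrameStd_tree _ he, htree e he]

/-- ★ `|fixCoord Y|² ≤ 12·Σ_w ‖Y w‖²` — the `X_fix` coordinates are controlled by the slot norms. [folklore] -/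
theorem fixCoord_dot_self_le (Y : ((Fin (2 * L - 1 + 1) × Edge 3 L) ⊕ Site 3 L) → Matrix (Fin 2) (Fin 2) ℂ) :
    fixCoord (L := L) Y ⬝ᵥ fixCoord (L := L) Y ≤ 12 * ∑ w, ‖Y w‖ ^ 2 := by
  classical
  refine le_trans ?_ (stdCoord_sq_le (L := L) Y)
  -- the `X_fix` sum is the sum over the image of the injection `(v,a) ↦ (fixVar v, a)`
  set g : FixVar L × Fin 3 → ((Fin (2 * L - 1 + 1) × Edge 3 L) ⊕ Site 3 L) × Fin 3 := fun va => (fixVar va.1, va.2) with hg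
  have hginj : Function.Injective g := by
    rintro ⟨v, a⟩ ⟨v', a'⟩ h
    simp only [hg, Prod.mk.injEq] at h
    rw [fixVar_injective h.1, h.2]
  have hsum : fixCoord (L := L) Y ⬝ᵥ fixCoord (L := L) Y =
      ∑ j ∈ (Finset.univ : Finset (FixVar L × Fin 3)).image g, stdCoord (L := L) Y j * stdCoord (L := L) Y j := by
    rw [Finset.sum_image (fun x _ y _ h => hginj h)]
    rfl
  rw [hsum, dotProduct]
  exact Finset.sum_le_sum_of_subset_of_nonneg (Finset.subset_univ _) fun j _ _ => mul_self_nonneg _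

/-- The number of standard frame coordinates of `X_fix`. [folklore] -/
theorem card_fixFrameStd_index : Fintype.card (FixVar L × Fin 3) = 3 * Fintype.card (FixVar L) := card_fixFrame_index

end Summit.QuantumFields.YangMills.Theorems.VirialFluxGap.FixFrame

end
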